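import Mathlib
import Summits.NavierStokesRegularity.NavierStokesRegularity.Theorems.TaoLadderRungTwoBreakOneShiftWindowGlueE
import Summits.NavierStokesRegularity.NavierStokesRegularity.Theorems.TaoLadderRungTwoBreakOneShiftWindowGlueE2
import Summits.NavierStokesRegularity.NavierStokesRegularity.Theorems.TaoLadderRungTwoBreakOneShiftWindowKrawczyk
import HarnessLib

/-!
# The one-shift window system, LXI: THE KRAWCZYK-INCLUSION CLAUSE OF A ROW FROM THE REPLAY BOOLEANS —
# `hwinIn_of_gridCE`: (K1) by part LVIII `K1_of_gridCE` + (K3) by part LIX `K3_of_gridCE` (same Krawczyk datum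
# `k3.kd`) + the dyadic test `YD + ZD ≤ 1` ⇒ part V `krawczyk_winIn` ⇒ the raw window output of every `AdmLip`
# point of the constructed certificate `windowCertOfMatrix` lies in the unit box (clause `hwinIn` of the certificate
# side) (cell harvest/h2-tao-ladder, seat p2; rung1/RUNG1-P2G14-REPORT §67/§69, RUNG1-P2G15-REPORT §71–§73; support
# for K1(1) = `NoSurvivingDSSOne`, stmt-NavierStokesRegularity-20205)

What remains instance-side after this theorem: the Booleans (one `native_decide` file each), the `FrameMatch` /
box-centre / section / time facts, the injectivity `hC` of the preconditioner, and the term-data triple (for T4W76: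
`termData_presT4`). MODEL lattice ODEs only (Tao 2016 §4 normal form on Tao's shift set `S`); nothing here is a
statement about the Navier–Stokes equations; no item is closed; no instance is evaluated here.
-/

noncomputable section

-- the sub-problem namespace repeats the summit name by design (D-0017)
set_option linter.dupNamespace false

namespace Summit.NavierStokesRegularity.NavierStokesRegularity.Theorems

namespace DSSOneShift

open Set Finset Metric Filter Topology TopologicalSpace
open Literature.Analysis.ODE Literature.Analysis.FluidPDE Literature.Analysis.FluidPDE.TaoCascade
open Summit.NavierStokesRegularity.NavierStokesRegularity.Theorems.TaylorModelCert
open Summit.NavierStokesRegularity.NavierStokesRegularity.Theorems.TaylorModelReadout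
open Summit.NavierStokesRegularity.NavierStokesRegularity.Theorems.CertificateGlueOn

variable {m : ℕ}

namespace OneShiftFrame

variable (F : OneShiftFrame m)

section Glue

variable {ε₀ : ℝ} {α : Fin m → Fin m → Fin m → ℤ × ℤ × ℤ → ℝ} {R : ℤ → ℝ}
variable {g : GridCD} {k3 : K3D} {e : F.SIdx ≃ Fin g.n}
variable {κ : Type*} [Fintype κ]

/-- **THE KRAWCZYK-INCLUSION CLAUSE `hwinIn` OF A ONE-SHIFT ROW FROM THE REPLAY BOOLEANS + INSTANCE FACTS**:
parts LVIII (K1) and LIX (K3) on the centred end-of-step grid, the dyadic test `YD + ZD ≤ 1`, and part V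
`krawczyk_winIn`, for the constructed certificate `windowCertOfMatrix` with the preconditioner `linOfMatrix (kd.CmatR …)`.
[cite: Tao2016AveragedNS, §5.3; Neumaier1991, §5.1 (Krawczyk operator); cell vocabulary, harvest/h2-tao-ladder rung1/RUNG1-P2G14-REPORT.md §67/§69] -/
theorem hwinIn_of_gridCE (hε : 0 ≤ ε₀) (hα : IsCancellingCoeff α)
    (hEb : ∀ i, |F.tubeC i (-1)| + F.tubeR (-1) ≤ F.Eb) (hEt : ∀ i, |F.tubeC i F.W| + F.tubeR F.W ≤ F.Et)
    (M : F.FrameMatch g.toGridD k3.kd e R) (hkn : k3.kd.rs.n = g.n)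
    (hC : ∀ r, F.linOfMatrix (k3.kd.CmatR F (e.trans (finCongr hkn.symm))) r = 0 → r = 0)
    (Tc : ℕ → κ → BTerm F.SIdx) (rows : F.SIdx → List κ) (Tf : F.Space → ℝ → κ → BTerm F.SIdx)
    (hTf : ∀ u, F.AdmLip R u → ∀ t x, termField (Tf u t) x = F.wfieldFlat ε₀ α (F.preclampTail u) t x)
    (hRDc : ∀ s ≤ g.S, IsRTEncl (g.es e M.hn s) (Tc s) (Tc s) rows (g.step s).RD)
    (hRD : ∀ u, F.AdmLip R u → ∀ s ≤ g.S, ∀ r ∈ Ico 0 (g.h s).toReal,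
      IsRTEncl (g.es e M.hn s) (Tc s) (Tf u (g.t s + r)) rows (g.step s).RD)
    (hstep : ∀ s ≤ g.S, g.stepOK s = true) (hinit : g.initOK = true) (hprod : ∀ s < g.S, g.prodOKE s = true)
    (hprodS : g.prodOK g.S = true)
    (hpwf : ∀ s ≤ g.S, g.pwfOK s = true) (hpsub : ∀ s ≤ g.S, g.psubOK s = true)
    (hplink : ∀ s < g.S, g.plinkOK s = true) (hwlink : ∀ s < g.S, g.wlinkOK s = true) (hK1 : g.linkK1 k3.kd = true)
    (hP0 : (fun c : F.SIdx => F.yc c.1 ((c.2 : ℕ) : ℤ)) ∈ boxSet (boxOf e (g.P 0)))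
    (hyc : ∀ i (j : Fin F.W), IntervalD.mem (F.yc i ((j : ℕ) : ℤ)) (IntervalD.aget k3.ycB (e (i, j))))
    (hstrig : IntervalD.mem F.strig k3.strigB) (hTI : IntervalD.mem (F.τc - g.t g.S) k3.TI)
    (hzlink : ∀ c < g.n, IntervalD.subset ((g.step g.S).toRoughStepD.endBoxROnI (g.P g.S) k3.TI c) (IntervalD.aget k3.Zc c) = true)
    (hK3 : k3.check = true) (hYZ : Dyad.ble (k3.YD.add k3.kd.ZD) (Dyad.ofInt 1) = true) :
    ∀ u, F.AdmLip R u →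
      (∀ i k, |(F.rawWindow (F.windowCertOfMatrix hε (lt_trans zero_lt_one M.hW1) hα hEb hEt
          (F.linOfMatrix (k3.kd.CmatR F (e.trans (finCongr hkn.symm)))) hC) u).1 i k| ≤ 1) ∧
      |(F.rawWindow (F.windowCertOfMatrix hε (lt_trans zero_lt_one M.hW1) hα hEb hEt
          (F.linOfMatrix (k3.kd.CmatR F (e.trans (finCongr hkn.symm)))) hC) u).2| ≤ 1 := by
  classical
  intro u hu
  have hK1' := F.K1_of_gridCE hε hα hEb hEt M hkn Tc rows Tf hTf hRDc hRD hstep hinit hprod hprodS hpwf hpsub hplink hwlink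
    hK1 hP0
  have hK3' := F.K3_of_gridCE hε hα hEb hEt M hkn Tc rows Tf hTf hRDc hRD hstep hinit hprod hpwf hpsub hplink hwlink
    hP0 hyc hstrig hTI hzlink hK3
  -- the two dyadic scalars
  obtain ⟨-, -, -, -, -, -, -, hKc⟩ := g.of_linkK1 hK1
  have hZ : 0 ≤ k3.kd.ZD.toReal := by
    have hc := hKc
    unfold KrawD.check at hc
    simp only [Bool.and_eq_true, List.all_eq_true, List.mem_range] at hc
    simpa using (Dyad.ble_iff _ _).1 hc.1
  have hYZr : k3.YD.toReal + k3.kd.ZD.toReal ≤ 1 := by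
    have h := (Dyad.ble_iff _ _).1 hYZ
    simpa [Dyad.toReal_add] using h
  exact F.krawczyk_winIn hε (lt_trans zero_lt_one M.hW1) hα hEb hEt
    (F.linOfMatrix (k3.kd.CmatR F (e.trans (finCongr hkn.symm)))) hC R hZ hYZr hK1' hK3' u hu

end Glue

end OneShiftFrame

end DSSOneShift

end Summit.NavierStokesRegularity.NavierStokesRegularity.Theorems
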